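import Literature.MathematicalPhysics.QuantumFieldTheory.Balaban1983to89.Beta.MonotoneScales
import Summits.QuantumFields.BalabanUV.Beta.CapRowsTail

/-!
# Beta / GAN24 / MonotoneLoewner — LOEWNER CHAINS ⟹ ONE-DATUM ENTRYWISE MAJORANTS, and the first Bałaban instance: `QGQ*` (1.99)
# (gan24-p4, BINDER-OWNERS row G-an2-4 ∕ (CONV-C), ALTERNATIVE DISCHARGE «rate OR monotonicity»; NOT IN PRINT — our proof attempt)

HONEST FRAMING (page 1 of everything the β sub-cell writes): discharging `BetaPertH` makes Bałaban's UV stability UNCONDITIONAL — a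
real constructive-QFT result; it is NOT the continuum limit and NOT the Clay problem.  HONEST DEPENDENCY (cell reorg 2026-08-19, verbatim):
«continuum YM on T⁴ ⇐ BetaPertH ∧ nine spine estimates (0/9 proved); BetaPertH ⇐ (D1) ∧ (D4) ∧ CAP+tail; G-an2-4 gates asym, D1 and NE2/3/4.»
HONEST LABEL: «not in print; our proof attempt; alternative discharge of the G-an2-4 row (rate OR monotonicity)»; 0 wall binders instantiated.

ABSOLUTE RULE (cell charter, verbatim): "No internally-minted statement may enter as a cited fact. Every hypothesis is either
kernel-proved in this package or a verbatim quotation of a PUBLISHED theorem with page reference. The manuscript(s) under audit are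
NOT citable for their own disputed steps — they are the thing under adjudication; programme-internal (2001/route/tribunal) claims
are never citable."  Nothing is cited as a hypothesis.  The abstract principle of §1–§2 (a PSD matrix is entrywise dominated by its trace;
a Loewner chain is controlled by ONE trace datum) is classical linear algebra, re-proved here from Mathlib's `Matrix.PosSemidef`
(`det_nonneg` of the `2 × 2` principal minor, `diag_nonneg`, `trace_nonneg`); [folklore] throughout.

## WHAT THIS FILE SUPPLIES TO THE MONOTONE ROUTE (`GAN24/Monotone`, `GAN24/MonotoneCauchy`)
The route's structural input (MONO-K)₂ = `MonotoneCauchy.SupCauchyBand A η₀ k₀` (pairwise sup-deviations of the resolvent slot beyond `k₀` bounded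
by ONE datum).  §2 proves the MATRIX form of it for any LOEWNER CHAIN `P k₀ ≥ P (k₀+1) ≥ …` of Hermitian fibre matrices:
`‖(P j − P j') a b‖ ≤ η₀` for all `j, j' ≥ k₀` and all entries, where `η₀` bounds the TRACE LOST after `k₀` — e.g. `re tr P k₀ − (uniform trace floor)`
(`trace_datum_of_floor`); the trace majorant itself satisfies an5's socket `MonotoneTailDown` (`monotoneTailDown_re_trace`).  §3 is the FIRST
KERNEL-CHECKED INSTANCE ON A BAŁABAN `U = 1` CONSTITUENT: the transcribed Landau-gauge covariance fibre matrix `QGQ*^{(n)}(p′)` of [B5] (1.99)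
(`B5QGQ199Rate.qgq`, t4-ne2 lineage) is Hermitian (`qgq_isHermitian`), asym1's `MonotoneScales.qform_qgq_anti` makes `n ↦ QGQ*^{(n)}` a Loewner
chain along `n = Lc^j` (`posSemidef_qgq_sub_refine`, `posSemidef_qgq_pow_sub`), hence (MONO-K)₂ for its entries with one trace datum
(`qgq_entry_dev_le`), and UNCONDITIONALLY with the crude datum `η₀ = d·a⁻¹` read off the printed (1.100) (`qgq_entry_dev_le_crude`).
What is NOT here: the transfer from fibre-matrix entries to the wall's position-space kernels (p1's `abs_re_latticeKernel_le_of_norm_le` ∕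
`KInv_eq_re_latticeKernel` dictionary), and (MONO-K)₂ for the β lane's bordered KKT presentation `KInvStep` (its gauge∕multiplier rows are
not Loewner-ordered — `HOME/b2b-balaban-gan24-p4/MONOTONE.md` §3 V3∕V5, the located first step that does not follow).
-/

namespace Summit.QuantumFields.BalabanUV.Beta.GAN24.MonotoneLoewner

open scoped ComplexOrder BigOperators
open Matrix Finset
open Summit.QuantumFields.BalabanUV.Beta.CapRowsTail (MonotoneTailDown)

/-! ## §1 Entrywise size of a positive semidefinite complex matrix -/

section PSD

variable {n : Type*} {M : Matrix n n ℂ}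

/-- PSD ⟹ `‖M a b‖² ≤ re M a a · re M b b` (the `2 × 2` principal minor at `(a, b)` has nonnegative determinant). [folklore] -/
theorem norm_apply_sq_le (hM : M.PosSemidef) (a b : n) : ‖M a b‖ ^ 2 ≤ (M a a).re * (M b b).re := by
  have hS : (M.submatrix ![a, b] ![a, b]).PosSemidef := hM.submatrix _
  have hdet := hS.det_nonneg
  rw [Matrix.det_fin_two] at hdet
  simp only [Matrix.submatrix_apply, Matrix.cons_val_zero, Matrix.cons_val_one] at hdet
  have hba : M b a = (starRingEnd ℂ) (M a b) := by
    have := hM.isHermitian.apply b a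
    simpa using this.symm
  have haa := Complex.nonneg_iff.mp (hM.diag_nonneg (i := a))
  have hbb := Complex.nonneg_iff.mp (hM.diag_nonneg (i := b))
  rw [hba, Complex.mul_conj, Complex.nonneg_iff] at hdet
  obtain ⟨hre, _⟩ := hdet
  simp only [Complex.sub_re, Complex.mul_re, Complex.ofReal_re] at hre
  rw [← Complex.normSq_eq_norm_sq]
  nlinarith [haa.1, hbb.1, haa.2, hbb.2]

/-- PSD ⟹ every diagonal entry has nonnegative real part. [folklore] -/
theorem re_diag_nonneg (hM : M.PosSemidef) (a : n) : 0 ≤ (M a a).re :=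
  (Complex.nonneg_iff.mp (hM.diag_nonneg (i := a))).1

variable [Fintype n]

/-- `re tr M = Σ_a re M a a`. [folklore] -/
theorem re_trace_eq_sum (M : Matrix n n ℂ) : M.trace.re = ∑ a, (M a a).re := by
  rw [Matrix.trace, Complex.re_sum]
  rfl

/-- PSD ⟹ `re M a a ≤ re tr M`. [folklore] -/
theorem re_diag_le_re_trace (hM : M.PosSemidef) (a : n) : (M a a).re ≤ M.trace.re := by
  rw [re_trace_eq_sum]
  exact Finset.single_le_sum (f := fun a => (M a a).re) (fun i _ => re_diag_nonneg hM i) (Finset.mem_univ a)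

/-- **PSD ⟹ `‖M a b‖ ≤ re tr M`** (geometric mean ≤ arithmetic mean ≤ the trace). [folklore] -/
theorem norm_apply_le_re_trace (hM : M.PosSemidef) (a b : n) : ‖M a b‖ ≤ M.trace.re := by
  have h1 := norm_apply_sq_le hM a b
  have ha := re_diag_le_re_trace hM a
  have hb := re_diag_le_re_trace hM b
  have ha0 := re_diag_nonneg hM a
  have hb0 := re_diag_nonneg hM b
  nlinarith [norm_nonneg (M a b)]

/-- A Hermitian matrix whose quadratic form has nonnegative REAL PART is PSD (for Hermitian `M` the form is real). [folklore] -/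
theorem posSemidef_of_isHermitian_re_nonneg (hH : M.IsHermitian) (h : ∀ x : n → ℂ, 0 ≤ (star x ⬝ᵥ (M *ᵥ x)).re) :
    M.PosSemidef := by
  refine Matrix.PosSemidef.of_dotProduct_mulVec_nonneg hH fun x => ?_
  rw [Complex.nonneg_iff]
  refine ⟨h x, ?_⟩
  -- the form of a Hermitian matrix is real
  have him := hH.im_star_dotProduct_mulVec_self x
  rw [RCLike.im_eq_complex_im] at him
  exact him.symm

end PSD

/-! ## §2 Loewner chains: telescoping, antitone trace, ONE datum ⟹ pairwise entrywise bound -/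

section Chain

variable {n : Type*} {P : ℕ → Matrix n n ℂ} {k₀ : ℕ}

/-- A chain of PSD steps telescopes: `P j − P j'` is PSD for `k₀ ≤ j ≤ j'`. [folklore] -/
theorem posSemidef_sub_of_steps (hstep : ∀ j, k₀ ≤ j → (P j - P (j + 1)).PosSemidef) :
    ∀ j j', k₀ ≤ j → j ≤ j' → (P j - P j').PosSemidef := by
  intro j j' hj hjj'
  induction j', hjj' using Nat.le_induction with
  | base => simpa using Matrix.PosSemidef.zero
  | succ m hm ih =>
    have h := ih.add (hstep m (hj.trans hm))
    simpa [sub_add_sub_cancel] using h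

variable [Fintype n]

/-- Along a chain of PSD steps the real trace is NON-INCREASING from `k₀` — an5's socket `MonotoneTailDown` holds for the trace majorant. [folklore] -/
theorem monotoneTailDown_re_trace (hstep : ∀ j, k₀ ≤ j → (P j - P (j + 1)).PosSemidef) :
    MonotoneTailDown (fun j => (P j).trace.re) k₀ := by
  intro j hj
  have h := (hstep j hj).trace_nonneg
  rw [Matrix.trace_sub, Complex.nonneg_iff, Complex.sub_re] at h
  simpa using h.1

/-- **ONE DATUM ⟹ PAIRWISE ENTRYWISE BOUND.**  A chain of PSD steps from `k₀` and a bound `η₀` on the trace LOST after `k₀`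
(`re tr (P k₀ − P j) ≤ η₀` for all `j ≥ k₀`) give `‖(P j − P j') a b‖ ≤ η₀` for all `j, j' ≥ k₀` and all entries. [folklore] -/
theorem norm_sub_apply_le_of_steps (hstep : ∀ j, k₀ ≤ j → (P j - P (j + 1)).PosSemidef) {η₀ : ℝ}
    (hdat : ∀ j, k₀ ≤ j → (P k₀ - P j).trace.re ≤ η₀) :
    ∀ j j', k₀ ≤ j → k₀ ≤ j' → ∀ a b, ‖(P j - P j') a b‖ ≤ η₀ := by
  -- first for ordered pairs
  have key : ∀ j j', k₀ ≤ j → j ≤ j' → ∀ a b, ‖(P j - P j') a b‖ ≤ η₀ := by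
    intro j j' hj hjj' a b
    have hPSD := posSemidef_sub_of_steps hstep j j' hj hjj'
    have h1 := norm_apply_le_re_trace hPSD a b
    have h2 : (P j - P j').trace.re ≤ (P k₀ - P j').trace.re := by
      have h0 := (posSemidef_sub_of_steps hstep k₀ j le_rfl hj).trace_nonneg
      rw [Complex.nonneg_iff] at h0
      have e : P k₀ - P j' = (P k₀ - P j) + (P j - P j') := by abel
      rw [e, Matrix.trace_add, Complex.add_re]
      linarith [h0.1]
    exact h1.trans (h2.trans (hdat j' (hj.trans hjj')))
  intro j j' hj hj' a b
  rcases le_total j j' with h | h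
  · exact key j j' hj h a b
  · rw [← norm_neg, ← Matrix.neg_apply, neg_sub]
    exact key j' j hj' h a b

/-- The datum from a UNIFORM TRACE FLOOR: if `φ ≤ re tr (P j)` for all `j ≥ k₀` then `re tr (P k₀ − P j) ≤ re tr (P k₀) − φ`. [folklore] -/
theorem trace_datum_of_floor {φ : ℝ} (hfloor : ∀ j, k₀ ≤ j → φ ≤ (P j).trace.re) :
    ∀ j, k₀ ≤ j → (P k₀ - P j).trace.re ≤ (P k₀).trace.re - φ := by
  intro j hj
  rw [Matrix.trace_sub, Complex.sub_re]
  linarith [hfloor j hj]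

end Chain

/-! ## §3 FIRST INSTANCE ON A BAŁABAN `U = 1` CONSTITUENT: the Landau-gauge covariance fibre `QGQ*` (1.99)
(asym1's `MonotoneScales.qform_qgq_anti` + Hermitian symmetry of the transcribed fibre matrix ⟹ PSD chain along `n = Lc^j`
⟹ (MONO-K)₂ for its entries with ONE trace datum) -/

section QGQ

open Literature.MathematicalPhysics.QuantumFieldTheory.Balaban1983to89
open Literature.MathematicalPhysics.QuantumFieldTheory.Balaban1983to89.B5Prop11Fiber (d1Sym)
open Literature.MathematicalPhysics.QuantumFieldTheory.Balaban1983to89.B5Prop11Leaves (phiMu)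
open Literature.MathematicalPhysics.QuantumFieldTheory.Balaban1983to89.B5QGQ199Rate (qform qgq qform_sub ineq1100_upper ineq1100_lower)
open Literature.MathematicalPhysics.QuantumFieldTheory.Balaban1983to89.Beta.MonotoneScales (qform_qgq_anti)
open scoped ComplexConjugate Real

variable {d : ℕ}

/-- asym1's ∕ t4-ne2's quadratic form `qform A w = Σ_μ Σ_ν conj(w_μ) A_{μν} w_ν` IS Mathlib's `star w ⬝ᵥ (A *ᵥ w)`. [folklore] -/
theorem qform_eq_star_dotProduct_mulVec (A : Matrix (Fin d) (Fin d) ℂ) (w : Fin d → ℂ) :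
    qform A w = star w ⬝ᵥ (A *ᵥ w) := by
  unfold qform
  simp only [dotProduct, Matrix.mulVec, Pi.star_apply, Complex.star_def, Finset.mul_sum]
  refine Finset.sum_congr rfl fun μ _ => Finset.sum_congr rfl fun ν _ => ?_
  ring

/-- The transcribed (1.99) fibre matrix `qgq n a s` is Hermitian. [folklore] -/
theorem qgq_isHermitian (n : ℕ) [NeZero n] (a : ℝ) (s : Fin d → ℝ) : (qgq n a s).IsHermitian := by
  apply Matrix.IsHermitian.ext
  intro i j
  simp only [qgq]
  by_cases h : i = j
  · subst h
    simp only [if_true, Complex.star_def, map_add, map_sub, map_mul, map_one, Complex.conj_ofReal, Complex.conj_conj]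
    ring
  · have h' : j ≠ i := Ne.symm h
    simp only [h, h', if_false, Complex.star_def, map_mul, Complex.conj_ofReal, Complex.conj_conj, mul_zero, sub_zero,
      zero_add]
    ring

variable {N R : ℕ} [NeZero N] [NeZero R]

/-- **ONE AVERAGING STEP IS A PSD DECREMENT OF `QGQ*`**: for `a ≥ 0` and `p′ ≠ 0` in the zone, `QGQ*^{(N)}(p′) − QGQ*^{(RN)}(p′)` is positive
semidefinite (Mathlib `Matrix.PosSemidef`, `ℂ`-order) — asym1's `qform_qgq_anti` read through `qform = star w ⬝ᵥ A *ᵥ w`. [folklore] -/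
theorem posSemidef_qgq_sub_refine (hN : 1 ≤ N) (hR : 1 ≤ R) (a : ℝ) (ha : 0 ≤ a) (s : Fin d → ℝ) (hs : ∀ κ, |s κ| ≤ π)
    (ν₀ : Fin d) (hν₀ : s ν₀ ≠ 0) : (qgq N a s - qgq (R * N) a s).PosSemidef := by
  refine posSemidef_of_isHermitian_re_nonneg ((qgq_isHermitian N a s).sub (qgq_isHermitian (R * N) a s)) fun w => ?_
  rw [← qform_eq_star_dotProduct_mulVec, qform_sub, Complex.sub_re, sub_nonneg]
  exact qform_qgq_anti hN hR a ha s hs ν₀ hν₀ w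

/-- the same along POWERS of the block size: `QGQ*^{(Lc^j)} − QGQ*^{(Lc^{j+i})}` is PSD. [folklore] -/
theorem posSemidef_qgq_pow_sub (Lc : ℕ) [NeZero Lc] (a : ℝ) (ha : 0 ≤ a) (s : Fin d → ℝ) (hs : ∀ κ, |s κ| ≤ π)
    (ν₀ : Fin d) (hν₀ : s ν₀ ≠ 0) (j i : ℕ) : (qgq (Lc ^ j) a s - qgq (Lc ^ (j + i)) a s).PosSemidef := by
  have hj : 1 ≤ Lc ^ j := Nat.one_le_iff_ne_zero.mpr (NeZero.ne _)
  have hi : 1 ≤ Lc ^ i := Nat.one_le_iff_ne_zero.mpr (NeZero.ne _)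
  have h := posSemidef_qgq_sub_refine (N := Lc ^ j) (R := Lc ^ i) hj hi a ha s hs ν₀ hν₀
  convert h using 4
  rw [pow_add, mul_comm]

/-- **(MONO-K)₂ FOR THE ENTRIES OF `QGQ*` ALONG `n = Lc^j`, ONE TRACE DATUM**: if the trace lost after step `k₀` is at most `η₀`
(`re tr (QGQ*^{(Lc^{k₀})} − QGQ*^{(Lc^j)}) ≤ η₀` for `j ≥ k₀`), then every entry moves by at most `η₀` between any two steps `j, j' ≥ k₀`. [folklore] -/
theorem qgq_entry_dev_le (Lc : ℕ) [NeZero Lc] (a : ℝ) (ha : 0 ≤ a) (s : Fin d → ℝ) (hs : ∀ κ, |s κ| ≤ π) (ν₀ : Fin d)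
    (hν₀ : s ν₀ ≠ 0) {k₀ : ℕ} {η₀ : ℝ}
    (hdat : ∀ j, k₀ ≤ j → (qgq (Lc ^ k₀) a s - qgq (Lc ^ j) a s).trace.re ≤ η₀) :
    ∀ j j', k₀ ≤ j → k₀ ≤ j' → ∀ μ ν, ‖(qgq (Lc ^ j) a s - qgq (Lc ^ j') a s) μ ν‖ ≤ η₀ :=
  norm_sub_apply_le_of_steps (P := fun j => qgq (Lc ^ j) a s) (fun j _ => posSemidef_qgq_pow_sub Lc a ha s hs ν₀ hν₀ j 1) hdat

/-- the trace majorant is non-increasing along `n = Lc^j` (an5's socket `MonotoneTailDown`, from `k₀ = 0`). [folklore] -/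
theorem monotoneTailDown_re_trace_qgq (Lc : ℕ) [NeZero Lc] (a : ℝ) (ha : 0 ≤ a) (s : Fin d → ℝ) (hs : ∀ κ, |s κ| ≤ π)
    (ν₀ : Fin d) (hν₀ : s ν₀ ≠ 0) : MonotoneTailDown (fun j => (qgq (Lc ^ j) a s).trace.re) 0 :=
  monotoneTailDown_re_trace (P := fun j => qgq (Lc ^ j) a s) fun j _ => posSemidef_qgq_pow_sub Lc a ha s hs ν₀ hν₀ j 1

/-- the form at a basis vector is the diagonal entry. [folklore] -/
theorem qform_single (A : Matrix (Fin d) (Fin d) ℂ) (μ : Fin d) : qform A (Pi.single μ 1) = A μ μ := by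
  unfold qform
  simp [Pi.single_apply, Finset.sum_ite_eq']

/-- `Σ_κ ‖e_μ κ‖² = 1`. [folklore] -/
theorem sum_norm_sq_single (μ : Fin d) : ∑ κ : Fin d, ‖(Pi.single μ (1 : ℂ) : Fin d → ℂ) κ‖ ^ 2 = 1 := by
  rw [Finset.sum_eq_single μ (fun κ _ hκ => by simp [hκ]) (fun h => absurd (Finset.mem_univ μ) h)]
  simp

/-- THE PRINTED TWO-SIDED BOUND (1.100) ON THE DIAGONAL: `0 ≤ re QGQ*^{(n)}(p′)_{μμ} ≤ a⁻¹` (`φ_μ ≥ 1`). [folklore] -/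
theorem re_diag_qgq_bounds (n : ℕ) [NeZero n] (hn : 1 ≤ n) (a : ℝ) (ha : 0 < a) (s : Fin d → ℝ) (hs : ∀ κ, |s κ| ≤ π)
    (ν₀ : Fin d) (hν₀ : s ν₀ ≠ 0) (μ : Fin d) : 0 ≤ ((qgq n a s) μ μ).re ∧ ((qgq n a s) μ μ).re ≤ a⁻¹ := by
  have hup := ineq1100_upper n hn a ha s hs ν₀ hν₀ (Pi.single μ 1)
  have hlo := ineq1100_lower n hn a ha s hs ν₀ hν₀ (Pi.single μ 1)
  rw [qform_single] at hup hlo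
  rw [sum_norm_sq_single, mul_one] at hup
  refine ⟨le_trans (mul_nonneg (inv_nonneg.mpr ha.le) (Finset.sum_nonneg fun κ _ => mul_nonneg ?_ (sq_nonneg _))) hlo, hup⟩
  have hφ := B5Prop11Leaves.one_le_phiMu n a ha.le κ s
  have hφ0 : 0 < phiMu n a κ s := by linarith
  rw [sub_nonneg, div_le_one hφ0]
  exact hφ

/-- hence `0 ≤ re tr QGQ*^{(n)}(p′) ≤ d·a⁻¹`. [folklore] -/
theorem re_trace_qgq_bounds (n : ℕ) [NeZero n] (hn : 1 ≤ n) (a : ℝ) (ha : 0 < a) (s : Fin d → ℝ) (hs : ∀ κ, |s κ| ≤ π)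
    (ν₀ : Fin d) (hν₀ : s ν₀ ≠ 0) : 0 ≤ (qgq n a s).trace.re ∧ (qgq n a s).trace.re ≤ d * a⁻¹ := by
  rw [re_trace_eq_sum]
  refine ⟨Finset.sum_nonneg fun μ _ => (re_diag_qgq_bounds n hn a ha s hs ν₀ hν₀ μ).1, ?_⟩
  calc ∑ μ : Fin d, ((qgq n a s) μ μ).re ≤ ∑ _μ : Fin d, a⁻¹ :=
        Finset.sum_le_sum fun μ _ => (re_diag_qgq_bounds n hn a ha s hs ν₀ hν₀ μ).2
    _ = d * a⁻¹ := by simp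

/-- **(MONO-K)₂ FOR `QGQ*`, UNCONDITIONALLY** with the CRUDE datum `η₀ = d·a⁻¹` from (1.100): for `a > 0`, `p′ ≠ 0` and ALL `j, j'`, every entry of
`QGQ*^{(Lc^j)}(p′) − QGQ*^{(Lc^{j'})}(p′)` has norm at most `d·a⁻¹` (a sharp `η₀` is ONE certified trace datum at one scale `k₀`). [folklore] -/
theorem qgq_entry_dev_le_crude (Lc : ℕ) [NeZero Lc] (a : ℝ) (ha : 0 < a) (s : Fin d → ℝ) (hs : ∀ κ, |s κ| ≤ π)
    (ν₀ : Fin d) (hν₀ : s ν₀ ≠ 0) :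
    ∀ j j' (μ ν : Fin d), ‖(qgq (Lc ^ j) a s - qgq (Lc ^ j') a s) μ ν‖ ≤ d * a⁻¹ := by
  intro j j' μ ν
  refine qgq_entry_dev_le Lc a ha.le s hs ν₀ hν₀ (k₀ := 0) (fun i _ => ?_) j j' (Nat.zero_le _) (Nat.zero_le _) μ ν
  have h0 := re_trace_qgq_bounds (Lc ^ 0) (Nat.one_le_iff_ne_zero.mpr (NeZero.ne _)) a ha s hs ν₀ hν₀
  have hi := re_trace_qgq_bounds (Lc ^ i) (Nat.one_le_iff_ne_zero.mpr (NeZero.ne _)) a ha s hs ν₀ hν₀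
  rw [Matrix.trace_sub, Complex.sub_re]
  linarith [h0.2, hi.1]

end QGQ

end Summit.QuantumFields.BalabanUV.Beta.GAN24.MonotoneLoewner
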